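import Summits.Ventures.Crystal3D.Theorems.StickyWulffConstantGenericWallFloorTailSeparation
import Summits.Ventures.Crystal3D.Theorems.StickyWulffConstantGenericWallFloorResidualCoverageDefs
import HarnessLib

/-!
# The uniform tail of the certificate in the kernel, part 2: unread tilted pairs are `SeparatedTiltAtCharge c₀`
# (crux `GenericWallFloor`, stmt-Ventures-19480, line `WallLedgerG`; ROCERT-g13 §4's THEOREM by name)

HONEST FRAMING. Part of the venture `Summits/Ventures/Crystal3D` (cell `crystal3d-full`), helper `--supports` the crux `GenericWallFloor`.
Rung credit only; census-free, standard axioms; F-C1 not moved.  Sequel of `…TailSeparation` (`stackFrames_separated_of_unread`).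

* **`separatedTiltAtCharge_of_unread`** — tilt caps `‖z₁ − e₃‖ ≤ 1/3`, `‖z₂ + e₃‖ ≤ 1/3`, `u₁` `z₁`-steep, `u₂` `z₂`-steep, flux
  `√2|⟪A₁u₁,e₃⟫| + √2|⟪A₂u₂,e₃⟫| ≥ 2c₀`, and the two read bounds with `d + c + 2 ≤ |κ|` ⇒ `SeparatedTiltAtCharge c₀ A₁ A₂`, hence
  `CoveredAtCharge c₀ A₁ A₂` (`coveredAtCharge_of_unread`).  With `d = c = 4` this is ROCERT-g13 §4 for every `|κ| ≥ 10`: the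
  certificate's tail datum per box (two families with disjoint length-5 forced-ray prefix sets ⇒ for every word one of them is unread
  on both grains, caps, steepness, flux `≥ 3/5 + 3/5`) now feeds a TREE theorem.
WHAT THIS IS NOT: the 612-box datum stays computational; not the stub; F-C1 not moved.
-/

noncomputable section

namespace Summit.Ventures.Crystal3D.Theorems

open Summit.Ventures.Crystal3D Finset
open Literature.MathematicalPhysics.StatisticalMechanics (fccStacking barlowStacking IsHaggSeq)
open scoped InnerProductSpace

/-- **ROCERT-g13 §4 in the kernel: an UNREAD tilted steering pair with enough flux gives `SeparatedTiltAtCharge c₀`.**  Tilt caps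
`‖z₁ − e₃‖ ≤ 1/3`, `‖z₂ + e₃‖ ≤ 1/3`, `u₁` `z₁`-steep, `u₂` `z₂`-steep, flux `√2|⟪A₁u₁,e₃⟫| + √2|⟪A₂u₂,e₃⟫| ≥ 2c₀`, and the two
read bounds of `chainFrames_separated_of_unread` with `d + c + 2 ≤ |κ|`. -/
theorem separatedTiltAtCharge_of_unread {z₁ z₂ : EuclideanSpace ℝ (Fin 3)}
    {A₁ A₂ : EuclideanSpace ℝ (Fin 3) ≃ₗᵢ[ℝ] EuclideanSpace ℝ (Fin 3)} {u₁ u₂ : EuclideanSpace ℝ (Fin 3)}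
    {κ : List (EuclideanSpace ℝ (Fin 3))} {c₀ : ℝ}
    (hκl : ∀ μ ∈ κ, ‖μ‖ = 1 ∧
      ∀ w ∈ fccSlots, ⟪w, μ⟫_ℝ = 0 ∨ ⟪w, μ⟫_ℝ = Real.sqrt (2 / 3) ∨ ⟪w, μ⟫_ℝ = -Real.sqrt (2 / 3))
    (hκc : List.IsChain (fun μ μ' => ⟪μ, μ'⟫_ℝ = 1 / 3 ∨ ⟪μ, μ'⟫_ℝ = -1 / 3) κ)
    (hA₂ : A₂ '' fccStacking 1 (Real.sqrt (2 / 3)) = (wordFrame A₁ κ) '' fccStacking 1 (Real.sqrt (2 / 3)))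
    (hz₁ : ‖z₁‖ = 1) (hze₁ : ‖z₁ - EuclideanSpace.single (2 : Fin 3) (1 : ℝ)‖ ≤ 1 / 3)
    (hz₂ : ‖z₂‖ = 1) (hze₂ : ‖z₂ + EuclideanSpace.single (2 : Fin 3) (1 : ℝ)‖ ≤ 1 / 3)
    (hu₁ : u₁ ∈ fccSlots) (hsteep₁ : Real.sqrt 2 / 2 ≤ ⟪A₁ u₁, z₁⟫_ℝ)
    (hu₂ : u₂ ∈ fccSlots) (hsteep₂ : Real.sqrt 2 / 2 ≤ ⟪A₂ u₂, z₂⟫_ℝ)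
    (hflux : 2 * c₀ ≤ Real.sqrt 2 * |⟪A₁ u₁, EuclideanSpace.single (2 : Fin 3) (1 : ℝ)⟫_ℝ| +
      Real.sqrt 2 * |⟪A₂ u₂, EuclideanSpace.single (2 : Fin 3) (1 : ℝ)⟫_ℝ|)
    {d c : ℕ} (hdc : d + c + 2 ≤ κ.length)
    (hread₁ : ∀ n₁ : EuclideanSpace ℝ (Fin 3), ‖n₁‖ = 1 →
      (∀ w ∈ fccSlots, ⟪A₁ w, n₁⟫_ℝ = 0 ∨ ⟪A₁ w, n₁⟫_ℝ = Real.sqrt (2 / 3) ∨ ⟪A₁ w, n₁⟫_ℝ = -Real.sqrt (2 / 3)) →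
      ⟪A₁ u₁, n₁⟫_ℝ = Real.sqrt (2 / 3) →
      (rayWord z₁ ⟨A₁, u₁, 0⟩ n₁ (d + 1)).map (fun μ => (ℝ ∙ μ)ᗮ.reflection) ≠
        (κ.drop (κ.length - (d + 1))).map (fun μ => (ℝ ∙ μ)ᗮ.reflection))
    (hread₂ : ∀ (S : EuclideanSpace ℝ (Fin 3) ≃ₗᵢ[ℝ] EuclideanSpace ℝ (Fin 3)),
      S '' fccStacking 1 (Real.sqrt (2 / 3)) = fccStacking 1 (Real.sqrt (2 / 3)) →
      A₁ '' fccStacking 1 (Real.sqrt (2 / 3)) =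
        (wordFrame A₂ (κ.reverse.map S)) '' fccStacking 1 (Real.sqrt (2 / 3)) →
      ∀ n₂ : EuclideanSpace ℝ (Fin 3), ‖n₂‖ = 1 →
        (∀ w ∈ fccSlots, ⟪A₂ w, n₂⟫_ℝ = 0 ∨ ⟪A₂ w, n₂⟫_ℝ = Real.sqrt (2 / 3) ∨ ⟪A₂ w, n₂⟫_ℝ = -Real.sqrt (2 / 3)) →
        ⟪A₂ u₂, n₂⟫_ℝ = Real.sqrt (2 / 3) →
        (rayWord z₂ ⟨A₂, u₂, 0⟩ n₂ (c + 1)).map (fun μ => (ℝ ∙ μ)ᗮ.reflection) ≠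
          ((κ.reverse.map S).drop (κ.length - (c + 1))).map (fun μ => (ℝ ∙ μ)ᗮ.reflection)) :
    SeparatedTiltAtCharge c₀ A₁ A₂ :=
  ⟨z₁, z₂, u₁, u₂, hz₁, hze₁, hz₂, hze₂, hu₁, hsteep₁, hu₂, hsteep₂, hflux,
    stackFrames_separated_of_unread hκl hκc hA₂ hdc hread₁ hread₂⟩

/-- **Unread tilted pairs are covered at charge `c₀`** (third disjunct of `CoveredAtCharge`). -/
theorem coveredAtCharge_of_unread {z₁ z₂ : EuclideanSpace ℝ (Fin 3)}
    {A₁ A₂ : EuclideanSpace ℝ (Fin 3) ≃ₗᵢ[ℝ] EuclideanSpace ℝ (Fin 3)} {u₁ u₂ : EuclideanSpace ℝ (Fin 3)}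
    {κ : List (EuclideanSpace ℝ (Fin 3))} {c₀ : ℝ}
    (hκl : ∀ μ ∈ κ, ‖μ‖ = 1 ∧
      ∀ w ∈ fccSlots, ⟪w, μ⟫_ℝ = 0 ∨ ⟪w, μ⟫_ℝ = Real.sqrt (2 / 3) ∨ ⟪w, μ⟫_ℝ = -Real.sqrt (2 / 3))
    (hκc : List.IsChain (fun μ μ' => ⟪μ, μ'⟫_ℝ = 1 / 3 ∨ ⟪μ, μ'⟫_ℝ = -1 / 3) κ)
    (hA₂ : A₂ '' fccStacking 1 (Real.sqrt (2 / 3)) = (wordFrame A₁ κ) '' fccStacking 1 (Real.sqrt (2 / 3)))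
    (hz₁ : ‖z₁‖ = 1) (hze₁ : ‖z₁ - EuclideanSpace.single (2 : Fin 3) (1 : ℝ)‖ ≤ 1 / 3)
    (hz₂ : ‖z₂‖ = 1) (hze₂ : ‖z₂ + EuclideanSpace.single (2 : Fin 3) (1 : ℝ)‖ ≤ 1 / 3)
    (hu₁ : u₁ ∈ fccSlots) (hsteep₁ : Real.sqrt 2 / 2 ≤ ⟪A₁ u₁, z₁⟫_ℝ)
    (hu₂ : u₂ ∈ fccSlots) (hsteep₂ : Real.sqrt 2 / 2 ≤ ⟪A₂ u₂, z₂⟫_ℝ)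
    (hflux : 2 * c₀ ≤ Real.sqrt 2 * |⟪A₁ u₁, EuclideanSpace.single (2 : Fin 3) (1 : ℝ)⟫_ℝ| +
      Real.sqrt 2 * |⟪A₂ u₂, EuclideanSpace.single (2 : Fin 3) (1 : ℝ)⟫_ℝ|)
    {d c : ℕ} (hdc : d + c + 2 ≤ κ.length)
    (hread₁ : ∀ n₁ : EuclideanSpace ℝ (Fin 3), ‖n₁‖ = 1 →
      (∀ w ∈ fccSlots, ⟪A₁ w, n₁⟫_ℝ = 0 ∨ ⟪A₁ w, n₁⟫_ℝ = Real.sqrt (2 / 3) ∨ ⟪A₁ w, n₁⟫_ℝ = -Real.sqrt (2 / 3)) →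
      ⟪A₁ u₁, n₁⟫_ℝ = Real.sqrt (2 / 3) →
      (rayWord z₁ ⟨A₁, u₁, 0⟩ n₁ (d + 1)).map (fun μ => (ℝ ∙ μ)ᗮ.reflection) ≠
        (κ.drop (κ.length - (d + 1))).map (fun μ => (ℝ ∙ μ)ᗮ.reflection))
    (hread₂ : ∀ (S : EuclideanSpace ℝ (Fin 3) ≃ₗᵢ[ℝ] EuclideanSpace ℝ (Fin 3)),
      S '' fccStacking 1 (Real.sqrt (2 / 3)) = fccStacking 1 (Real.sqrt (2 / 3)) →
      A₁ '' fccStacking 1 (Real.sqrt (2 / 3)) =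
        (wordFrame A₂ (κ.reverse.map S)) '' fccStacking 1 (Real.sqrt (2 / 3)) →
      ∀ n₂ : EuclideanSpace ℝ (Fin 3), ‖n₂‖ = 1 →
        (∀ w ∈ fccSlots, ⟪A₂ w, n₂⟫_ℝ = 0 ∨ ⟪A₂ w, n₂⟫_ℝ = Real.sqrt (2 / 3) ∨ ⟪A₂ w, n₂⟫_ℝ = -Real.sqrt (2 / 3)) →
        ⟪A₂ u₂, n₂⟫_ℝ = Real.sqrt (2 / 3) →
        (rayWord z₂ ⟨A₂, u₂, 0⟩ n₂ (c + 1)).map (fun μ => (ℝ ∙ μ)ᗮ.reflection) ≠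
          ((κ.reverse.map S).drop (κ.length - (c + 1))).map (fun μ => (ℝ ∙ μ)ᗮ.reflection)) :
    CoveredAtCharge c₀ A₁ A₂ :=
  Or.inr (Or.inr (separatedTiltAtCharge_of_unread hκl hκc hA₂ hz₁ hze₁ hz₂ hze₂ hu₁ hsteep₁ hu₂ hsteep₂ hflux hdc hread₁ hread₂))

end Summit.Ventures.Crystal3D.Theorems

end
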